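import Summits.QuantumFields.YangMills.Theorems.FluctuationComparisonRegPrIntLTailSupOneFibreRows
import Summits.QuantumFields.YangMills.Theorems.BalabanUVNodesN14ConvexFibreTilt
import Mathlib.Analysis.Convex.Integral
import HarnessLib

/-!
# `FluctuationComparisonRegPrIntLTailSupOneDeletedTermJensen` — LINE g21-2 «DEPTH-ONE WINDOW ODDS BY A MEASURE SPLIT»: THE PROBABILISTIC HALF OF FPT ∕ FAR₁ IS A
# FIRST-MOMENT BOUND — the deleted-plaquette partition function by JENSEN, and the first moment by the sub-Gaussian second moment
# (crux `UnitScaleTilt.FluctuationComparisonRegPrIntL`, stmt-QuantumFields-20520; rows FPT `PinnedFarOddsDepthOneCan` ∕ FAR₁ of `Cruxes/…/Lines/tailsup_one.lean` v1.3+,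
# ideator ym-r3-idea-1 g21)

Cell `ym3-torus` (YM ladder rung R3 = continuum SU(2) Yang–Mills on T³ — a RUNG, NOT the Clay problem: not d = 4, not infinite volume, not a mass gap);
width seat `ym-ust-20520-w3` (gen 17); helper `--supports stmt-QuantumFields-20520`.  THEOREMS ONLY (0 `def`, 0 `sorry`, default heartbeats).

WHY.  After `…TailSupOneFarPlaquetteCost` (H) an FPT hand owes, per window datum, the DELETED-PLAQUETTE PARTITION BOUND `∫⁻ e^{−βA_{¬p}} dκ ≤ C·∫⁻ e^{−βA} dκ`
(«freeing plaquette `p`'s own term costs a bounded factor»).  Writing `ρ := e^{−βA_{¬p}}·κ` (the deleted weight) and `φ := β(1 − Re tr U(∂p)) ≥ 0` (the deleted term),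
this is `ρ(univ) ≤ C·∫ e^{−φ} dρ`, and JENSEN gives it with `C = exp(⨍ φ dρ)`: the bounded factor is the exponential of the MEAN DELETED ACTION under the deleted law.
So FPT's probabilistic half is a FIRST-MOMENT statement «`E_{deleted law}[β(1 − Re tr U(∂p))] ≤ M`, uniformly in the window datum and the volume» — equipartition
for one plaquette whose links stay confined by their other plaquettes — and under uniform convexity of the deleted action in the chart that first moment is
DIMENSION-FREE by the sub-Gaussian second moment (Track A's ✓`integral_sq_le_of_hasSubgaussianMGF`).
* §1 (generic, any finite non-zero measure `ρ`, measurable `φ ≥ 0` integrable) ★★`measureReal_le_exp_average_mul_integral_exp_neg` — `ρ(univ) ≤ e^{⨍φ dρ}·∫ e^{−φ} dρ`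
  (Jensen `ConvexOn.map_average_le` for `exp` at `−φ`); ★★`measure_le_exp_mul_lintegral_exp_neg` — the same in `ℝ≥0∞` with any `M ≥ ⨍ φ dρ`.
* §2 ★`average_le_of_sq_dom` (`φ ≤ a·G² + b` ⇒ `⨍φ ≤ a·⨍G² + b`) and ★`integral_sq_le_of_subgaussian_centred` (`G − ∫G` sub-Gaussian `c` under a probability law ⇒
  `∫ G² ≤ c + (∫G)²`) — the first moment from a quadratic domination and a sub-Gaussian constant.
* §3 (fine fields, any finite measure `κ`) ★★★`deletedPartition_le_of_average` — with `ρ = κ.withDensity e^{−βA_{¬p}}`: `⨍ β(1 − Re tr U(∂p)) dρ ≤ M` ⟹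
  `∫⁻ e^{−βA_{¬p}} dκ ≤ ofReal(e^{M})·∫⁻ e^{−βA} dκ` — EXACTLY the hypothesis `hdel` of H's `far_fibre_of_deletedPartition` ∕ `gibbsK_restrict_map_farPinned_le` at `G := univ`
  (the far row relative to the FULL fibre mass; B's bad-fraction lemma ∕ G's `mass_le_of_comparison` turn «relative to full» into «relative to good»).
HONEST SCOPE.  Jensen + moment bookkeeping; the first-moment bound (and the convexity behind it) is the HYPOTHESIS; FPT, FAR₁, MOD₁, TAILSUP₁, LFR♯ᶜ, S2β, 20520,
`YM3TorusSU2` NOT proved; the Yang–Mills mass gap is NOT proved.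
References: [Balaban1985UV3] (11) p. 258, (67)–(71) p. 273; [BakryGentilLedoux2014] Prop. 5.4.1; [BoucheronLugosiMassart2013] §2.3.
-/

noncomputable section

set_option autoImplicit false

open MeasureTheory ProbabilityTheory Filter Topology Set
open scoped ENNReal NNReal
open Literature.MathematicalPhysics.QuantumFieldTheory.Balaban1983to89
open Literature.MathematicalPhysics.QuantumFieldTheory.Balaban1983to89.Missing
open YMDAG.N14.ConvexFibreTilt (integral_sq_le_of_hasSubgaussianMGF)

namespace Summit.QuantumFields.YangMills.Theorems.FluctuationComparisonRegPrIntLTailSupOneDeletedTermJensen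

/-! ## §1 Jensen: a deleted non-negative term costs at most the exponential of its mean -/

section Jensen

variable {X : Type*} [MeasurableSpace X] (ρ : Measure X) [IsFiniteMeasure ρ] [NeZero ρ] {φ : X → ℝ}

/-- ★★ **`ρ(univ) ≤ e^{⨍φ dρ}·∫ e^{−φ} dρ`** for a finite non-zero measure `ρ` and an integrable `φ ≥ 0`: Jensen for the convex `exp` at `−φ` gives
`e^{−⨍φ} ≤ ⨍ e^{−φ} = ρ(univ)⁻¹·∫ e^{−φ}`. [cite: BoucheronLugosiMassart2013, §2.3 (Jensen)] -/
theorem measureReal_le_exp_average_mul_integral_exp_neg (hφm : Measurable φ) (hφ0 : ∀ x, 0 ≤ φ x) (hφi : Integrable φ ρ) :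
    ρ.real univ ≤ Real.exp (⨍ x, φ x ∂ρ) * ∫ x, Real.exp (-φ x) ∂ρ := by
  have hexp_int : Integrable (fun x => Real.exp (-φ x)) ρ := by
    refine Integrable.of_bound (hφm.neg.exp.aestronglyMeasurable) 1 (Eventually.of_forall fun x => ?_)
    rw [Real.norm_eq_abs, abs_of_pos (Real.exp_pos _)]
    exact Real.exp_le_one_iff.mpr (by linarith [hφ0 x])
  -- Jensen: `exp (⨍ (−φ)) ≤ ⨍ exp (−φ)`
  have hJ : Real.exp (⨍ x, -φ x ∂ρ) ≤ ⨍ x, Real.exp (-φ x) ∂ρ :=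
    (convexOn_exp.map_average_le Real.continuous_exp.continuousOn isClosed_univ
      (Eventually.of_forall fun _ => mem_univ _) hφi.neg hexp_int)
  rw [average_neg] at hJ
  have e : ⨍ x, Real.exp (-φ x) ∂ρ = (ρ.real univ)⁻¹ * ∫ x, Real.exp (-φ x) ∂ρ := by
    rw [average_eq, smul_eq_mul]
  rw [e] at hJ
  have hρ0 : 0 < ρ.real univ := by
    rw [measureReal_def]
    exact ENNReal.toReal_pos (NeZero.ne _) (measure_ne_top ρ _)
  -- `e^{−a} ≤ r⁻¹ I` ⇒ `r e^{−a} ≤ I`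
  have h1 : ρ.real univ * Real.exp (-⨍ x, φ x ∂ρ) ≤ ∫ x, Real.exp (-φ x) ∂ρ := by
    calc ρ.real univ * Real.exp (-⨍ x, φ x ∂ρ) ≤ ρ.real univ * ((ρ.real univ)⁻¹ * ∫ x, Real.exp (-φ x) ∂ρ) :=
          mul_le_mul_of_nonneg_left hJ hρ0.le
      _ = ∫ x, Real.exp (-φ x) ∂ρ := mul_inv_cancel_left₀ hρ0.ne' _
  calc ρ.real univ = (ρ.real univ * Real.exp (-⨍ x, φ x ∂ρ)) * Real.exp (⨍ x, φ x ∂ρ) := by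
        rw [mul_assoc, ← Real.exp_add, neg_add_cancel, Real.exp_zero, mul_one]
    _ ≤ (∫ x, Real.exp (-φ x) ∂ρ) * Real.exp (⨍ x, φ x ∂ρ) := mul_le_mul_of_nonneg_right h1 (Real.exp_pos _).le
    _ = Real.exp (⨍ x, φ x ∂ρ) * ∫ x, Real.exp (-φ x) ∂ρ := mul_comm _ _

/-- ★★ **THE SAME IN `ℝ≥0∞`, WITH ANY BOUND `M` ON THE MEAN**: `⨍φ dρ ≤ M` ⟹ `ρ(univ) ≤ ofReal(e^{M})·∫⁻ ofReal(e^{−φ}) dρ`.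
[cite: BoucheronLugosiMassart2013, §2.3 (Jensen)] -/
theorem measure_le_exp_mul_lintegral_exp_neg (hφm : Measurable φ) (hφ0 : ∀ x, 0 ≤ φ x) (hφi : Integrable φ ρ) {M : ℝ}
    (hM : ⨍ x, φ x ∂ρ ≤ M) :
    ρ univ ≤ ENNReal.ofReal (Real.exp M) * ∫⁻ x, ENNReal.ofReal (Real.exp (-φ x)) ∂ρ := by
  have hexp_int : Integrable (fun x => Real.exp (-φ x)) ρ := by
    refine Integrable.of_bound (hφm.neg.exp.aestronglyMeasurable) 1 (Eventually.of_forall fun x => ?_)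
    rw [Real.norm_eq_abs, abs_of_pos (Real.exp_pos _)]
    exact Real.exp_le_one_iff.mpr (by linarith [hφ0 x])
  have h := measureReal_le_exp_average_mul_integral_exp_neg ρ hφm hφ0 hφi
  have h' : ρ.real univ ≤ Real.exp M * ∫ x, Real.exp (-φ x) ∂ρ :=
    h.trans (mul_le_mul_of_nonneg_right (Real.exp_le_exp.mpr hM) (integral_nonneg fun x => (Real.exp_pos _).le))
  rw [← ofReal_integral_eq_lintegral_ofReal hexp_int (Eventually.of_forall fun x => (Real.exp_pos _).le),
    ← ENNReal.ofReal_mul (Real.exp_pos _).le, ← ENNReal.ofReal_toReal (measure_ne_top ρ univ)]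
  exact ENNReal.ofReal_le_ofReal (by simpa only [measureReal_def] using h')

end Jensen

/-! ## §2 The first moment from a quadratic domination and a sub-Gaussian constant -/

section Moment

variable {X : Type*} [MeasurableSpace X]

/-- ★ `φ ≤ a·G² + b` pointwise, `φ` and `G²` integrable ⟹ `⨍ φ dρ ≤ a·⨍ G² dρ + b` (finite non-zero `ρ`). [folklore] -/
theorem average_le_of_sq_dom (ρ : Measure X) [IsFiniteMeasure ρ] [NeZero ρ] {φ G : X → ℝ} {a b : ℝ}
    (hdom : ∀ x, φ x ≤ a * G x ^ 2 + b) (hφi : Integrable φ ρ) (hGi : Integrable (fun x => G x ^ 2) ρ) :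
    ⨍ x, φ x ∂ρ ≤ a * ⨍ x, G x ^ 2 ∂ρ + b := by
  rw [average_eq', average_eq']
  have hφi' : Integrable φ ((ρ univ)⁻¹ • ρ) := hφi.smul_measure (ENNReal.inv_ne_top.mpr (NeZero.ne _))
  have hGi' : Integrable (fun x => G x ^ 2) ((ρ univ)⁻¹ • ρ) := hGi.smul_measure (ENNReal.inv_ne_top.mpr (NeZero.ne _))
  calc ∫ x, φ x ∂(ρ univ)⁻¹ • ρ ≤ ∫ x, (a * G x ^ 2 + b) ∂(ρ univ)⁻¹ • ρ :=
        integral_mono hφi' ((hGi'.const_mul a).add (integrable_const b)) hdom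
    _ = a * ∫ x, G x ^ 2 ∂(ρ univ)⁻¹ • ρ + b := by
        rw [integral_add (hGi'.const_mul a) (integrable_const b), integral_const_mul, integral_const, smul_eq_mul, probReal_univ, one_mul]

/-- ★ **SECOND MOMENT FROM A SUB-GAUSSIAN CONSTANT ABOUT THE MEAN**: under a probability law, `HasSubgaussianMGF (G − ∫G) c` ⟹ `∫ G² ≤ c + (∫G)²`
(Track A's ✓`integral_sq_le_of_hasSubgaussianMGF` on the centred observable + `G² = (G − m)² + 2m(G − m) + m²`). Under uniform convexity of the deleted action
in the chart, `c = L²∕λ′` (✓`…TailSupOneConvexTail` ∕ F-BOX engines) — dimension-free. [cite: BakryGentilLedoux2014, Prop. 5.4.1] -/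
theorem integral_sq_le_of_subgaussian_centred (ν : Measure X) [IsProbabilityMeasure ν] {G : X → ℝ} {c : ℝ≥0}
    (hGi : Integrable G ν) (h : HasSubgaussianMGF (fun x => G x - ∫ z, G z ∂ν) c ν) :
    ∫ x, G x ^ 2 ∂ν ≤ c + (∫ z, G z ∂ν) ^ 2 := by
  set m : ℝ := ∫ z, G z ∂ν with hm
  have hsq := integral_sq_le_of_hasSubgaussianMGF h
  have hc2 : Integrable (fun x => (G x - m) ^ 2) ν := (h.memLp 2).integrable_sq
  -- `G² = (G − m)² + 2m(G − m) + m²`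
  have hdecomp : ∀ x, G x ^ 2 = (G x - m) ^ 2 + 2 * m * (G x - m) + m ^ 2 := fun x => by ring
  have hlin : Integrable (fun x => 2 * m * (G x - m)) ν := (hGi.sub (integrable_const m)).const_mul _
  have hcen : ∫ x, (G x - m) ∂ν = 0 := by
    rw [integral_sub hGi (integrable_const m), integral_const, smul_eq_mul, probReal_univ, one_mul, hm, sub_self]
  have hsum : Integrable (fun x => (G x - m) ^ 2 + 2 * m * (G x - m)) ν := hc2.add hlin
  calc ∫ x, G x ^ 2 ∂ν = ∫ x, ((G x - m) ^ 2 + 2 * m * (G x - m) + m ^ 2) ∂ν := integral_congr_ae (Eventually.of_forall hdecomp)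
    _ = ∫ x, (G x - m) ^ 2 ∂ν + ∫ x, 2 * m * (G x - m) ∂ν + ∫ x, m ^ 2 ∂ν := by
        rw [integral_add hsum (integrable_const _), integral_add hc2 hlin]
    _ ≤ c + (∫ z, G z ∂ν) ^ 2 := by
        rw [integral_const_mul, hcen, mul_zero, add_zero, integral_const, smul_eq_mul, probReal_univ, one_mul, ← hm]
        linarith

end Moment

/-! ## §3 Fine fields: the deleted-plaquette partition bound from the mean deleted action (docks into H at `G := univ`) -/

section Fibre

variable {P : Params} (κ : Measure (GaugeField P 0 (Matrix.specialUnitaryGroup (Fin 2) ℂ))) [IsFiniteMeasure κ] {β : ℝ}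

/-- The deleted weight `e^{−βA_{¬p}} ≤ 1` (`β ≥ 0`), so `ρ := κ.withDensity e^{−βA_{¬p}}` is finite. [cite: Balaban1987RG1, (0.2) p.252] -/
theorem isFiniteMeasure_withDensity_deleted (hβ : 0 ≤ β) (p : Plaq P 0) :
    IsFiniteMeasure (κ.withDensity fun U => ENNReal.ofReal (Real.exp (-(β * (wilsonAction4 U - (1 - reTr (GaugeField.plaqHol U p))))))) := by
  have hmeas : Measurable fun U : GaugeField P 0 (Matrix.specialUnitaryGroup (Fin 2) ℂ) =>
      Real.exp (-(β * (wilsonAction4 U - (1 - reTr (GaugeField.plaqHol U p))))) :=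
    (((measurable_wilsonAction4 RegularGaugeGroup.measurable_reTr).sub
      (measurable_const.sub (RegularGaugeGroup.measurable_reTr.comp (Missing.measurable_plaqHol p)))).const_mul β).neg.exp
  refine isFiniteMeasure_withDensity_ofReal ?_
  refine ((integrable_const (1 : ℝ)).mono' hmeas.aestronglyMeasurable (Eventually.of_forall fun U => ?_)).hasFiniteIntegral
  rw [Real.norm_eq_abs, abs_of_pos (Real.exp_pos _)]
  refine Real.exp_le_one_iff.mpr ?_
  -- `A_{¬p} ≥ 0`: one plaquette's term is below the action
  have hle : 1 - reTr (GaugeField.plaqHol U p) ≤ wilsonAction4 U := by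
    unfold wilsonAction4 wilsonAction
    simp only [one_mul]
    exact Finset.single_le_sum (f := fun q => 1 - reTr (GaugeField.plaqHol U q))
      (fun q _ => by linarith [GaugeGroup.reTr_le_one (GaugeField.plaqHol U q)]) (Finset.mem_univ p)
  nlinarith

/-- ★★★ **THE DELETED-PLAQUETTE PARTITION BOUND FROM THE MEAN DELETED ACTION**: for any finite measure `κ` on the fine fields, `β ≥ 0`, a plaquette `p`, and the
deleted weight `ρ := κ.withDensity e^{−βA_{¬p}}` non-zero with `β(1 − Re tr U(∂p))` `ρ`-integrable and `⨍ β(1 − Re tr U(∂p)) dρ ≤ M`: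
`∫⁻ e^{−βA_{¬p}} dκ ≤ ofReal(e^{M})·∫⁻ ofReal(boltzmann β) dκ` — the hypothesis `hdel` of ✓`…TailSupOneFarPlaquetteCost.far_fibre_of_deletedPartition` ∕
`gibbsK_restrict_map_farPinned_le` at `G := univ` with `C := e^{M}`.  The hand's residual for FPT is thus «the mean of ONE plaquette's action under the deleted
fibre law is `≤ M`, uniformly» (equipartition; §2 under convexity). [cite: Balaban1985UV3, (67)-(71) p.273; BoucheronLugosiMassart2013, §2.3] -/
theorem deletedPartition_le_of_average (hβ : 0 ≤ β) (p : Plaq P 0)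
    [NeZero (κ.withDensity fun U => ENNReal.ofReal (Real.exp (-(β * (wilsonAction4 U - (1 - reTr (GaugeField.plaqHol U p)))))))]
    (hint : Integrable (fun U => β * (1 - reTr (GaugeField.plaqHol U p)))
      (κ.withDensity fun U => ENNReal.ofReal (Real.exp (-(β * (wilsonAction4 U - (1 - reTr (GaugeField.plaqHol U p))))))))
    {M : ℝ} (hM : ⨍ U, β * (1 - reTr (GaugeField.plaqHol U p))
      ∂(κ.withDensity fun U => ENNReal.ofReal (Real.exp (-(β * (wilsonAction4 U - (1 - reTr (GaugeField.plaqHol U p))))))) ≤ M) :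
    ∫⁻ U, ENNReal.ofReal (Real.exp (-(β * (wilsonAction4 U - (1 - reTr (GaugeField.plaqHol U p)))))) ∂κ ≤
      ENNReal.ofReal (Real.exp M) * ∫⁻ U, ENNReal.ofReal (boltzmann P β U) ∂κ := by
  haveI := isFiniteMeasure_withDensity_deleted κ hβ p
  set w : GaugeField P 0 (Matrix.specialUnitaryGroup (Fin 2) ℂ) → ℝ≥0∞ :=
    fun U => ENNReal.ofReal (Real.exp (-(β * (wilsonAction4 U - (1 - reTr (GaugeField.plaqHol U p)))))) with hw
  have hwm : Measurable w := by
    have : Measurable fun U : GaugeField P 0 (Matrix.specialUnitaryGroup (Fin 2) ℂ) =>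
        -(β * (wilsonAction4 U - (1 - reTr (GaugeField.plaqHol U p)))) :=
      ((measurable_wilsonAction4 RegularGaugeGroup.measurable_reTr).sub
        (measurable_const.sub (RegularGaugeGroup.measurable_reTr.comp (Missing.measurable_plaqHol p)))).const_mul β |>.neg
    exact this.exp.ennreal_ofReal
  have hφm : Measurable fun U : GaugeField P 0 (Matrix.specialUnitaryGroup (Fin 2) ℂ) => β * (1 - reTr (GaugeField.plaqHol U p)) :=
    (measurable_const.sub (RegularGaugeGroup.measurable_reTr.comp (Missing.measurable_plaqHol p))).const_mul β
  have hφ0 : ∀ U : GaugeField P 0 (Matrix.specialUnitaryGroup (Fin 2) ℂ), 0 ≤ β * (1 - reTr (GaugeField.plaqHol U p)) :=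
    fun U => mul_nonneg hβ (by linarith [GaugeGroup.reTr_le_one (GaugeField.plaqHol U p)])
  have hJ := measure_le_exp_mul_lintegral_exp_neg (κ.withDensity w) hφm hφ0 hint hM
  -- `ρ univ = ∫⁻ w dκ` and `∫⁻ e^{−φ} dρ = ∫⁻ w·e^{−φ} dκ = ∫⁻ boltzmann dκ`
  have hgm : Measurable fun U : GaugeField P 0 (Matrix.specialUnitaryGroup (Fin 2) ℂ) =>
      ENNReal.ofReal (Real.exp (-(β * (1 - reTr (GaugeField.plaqHol U p))))) := hφm.neg.exp.ennreal_ofReal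
  rw [withDensity_apply _ MeasurableSet.univ, Measure.restrict_univ,
    lintegral_withDensity_eq_lintegral_mul _ hwm hgm] at hJ
  refine hJ.trans (le_of_eq ?_)
  congr 1
  refine lintegral_congr fun U => ?_
  simp only [hw, Pi.mul_apply, boltzmann]
  rw [← ENNReal.ofReal_mul (Real.exp_pos _).le, ← Real.exp_add]
  congr 1
  ring_nf

end Fibre

end Summit.QuantumFields.YangMills.Theorems.FluctuationComparisonRegPrIntLTailSupOneDeletedTermJensen

end
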